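import Literature.Analysis.FluidPDE.MildSolutionsProofs
import Literature.Analysis.FluidPDE.FujitaKatoDictionary
import Literature.Analysis.FluidPDE.KatoLocalL3Exists
import Literature.Analysis.FluidPDE.HomSobolevWeakLimits
import Literature.Analysis.FunctionSpaces.FourierSobolevNormProofs
import HarnessLib

/-!
# `ρ_max^pure ≤ ρ_max`: reduction of `rusinSverakRhoMaxPure_le` to the persistence of
`Ḣ^{1/2} ∩ L²` regularity along bounded mild solutions

Analysis/FluidPDE file of the discharge programme for the named fact
`Literature.Analysis.FluidPDE.rusinSverakRhoMaxPure_le` (`MildSolutions.lean`, **ns.S14**): for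
`ν > 0` the Rusin–Šverák threshold over the full space `Ḣ^{1/2}` (`rusinSverakRhoMaxPure ν`,
global *Kato* solutions `C([0,∞); L³)`) is at most the finite-energy threshold
(`rusinSverakRhoMax ν`, global *Fujita–Kato* solutions `C([0,∞); Ḣ^{1/2} ∩ L²)`).

## The argument (as in the docstring of the fact) and what is proved here

Both thresholds are suprema of down-closed sets of radii, so the inequality says: every weakly
divergence-free `u₀ ∈ Ḣ^{1/2} ∩ L²` with `‖u₀‖_{Ḣ^{1/2}} < ρ_max^pure(ν)` has a global Fujita–Kato
solution. Such a `u₀` is an `L³` field (critical embedding, the tree's proved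
`eLpNorm_three_le_eHomSobolevSeminorm_half_holds`), represented in the bundled space `Ḣ^{1/2}` by
`HomSobolev.ofFun _ hu₀` (proved `HomSobolev.represents_ofFun_holds`) with the same norm
(`HomSobolev.enorm_ofFun`, from the proved `eLpNorm_fourier_homSobolevMeasure`), so it has a global
Kato solution `u ∈ C([0,∞); L³)` (`hasGlobalKatoSolution_of_lt_rusinSverakRhoMaxPure`). It remains
to see that this `u` is a global Fujita–Kato solution — **persistence of the `Ḣ^{1/2} ∩ L²`
regularity of the datum along the Kato solution** (`kato_fujitaKato_persistence` below; GKP 2016,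
p. 4: "it is well-known (due to the embeddings and "propagation of regularity" results, cf. e.g.
Gallagher–Iftimie–Planchon 2003) that `T*(u₀)` is independent of" the critical space; Rusin–Šverák
2011, §3: "the mild solutions have the same regularity as `U = S(t)u₀` … and this can be iterated
forward to the time interval where the solution exists"). This file PROVES the reduction of that
persistence to its analytic core and leaves the core as ONE named fact:

* `bounded_mild_fujitaKato_persistence` (named fact, the analytic core): an unforced mild
  solution `v` on `[0, T)` in `C([0,T); L³) ∩ L^∞((0,T) × ℝ³)` whose datum lies in
  `Ḣ^{1/2} ∩ L²` stays in `C([0,T); Ḣ^{1/2} ∩ L²) ∩ C([0,T); L²)`. (Printed ingredients: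
  Lemarié-Rieusset 2016, proof of Thm. 15.1 (A), PDF p. 565 — for Kato's solution
  `u ∈ C([0,T*), L³)`, "`∫₀ᵗ W_{ν(t-s)} * ℙ div(u ⊗ u) ds ∈ C([0,S], L²) ∩ L²((0,S), H¹)`"; proof
  of Thm. 7.4, PDF p. 151 — the heat estimates `‖W_{νσ} * ℙ f‖_{Ḣ^{1/2}} ≤ C (νσ)^{-1/4} ‖f‖₂`,
  `‖W_{νσ} * ℙ f‖_{Ḣ^{3/2}} ≤ C (νσ)^{-3/4} ‖f‖₂`; with `v ⊗ v ∈ L^∞_t L²_x` for bounded `v ∈ C_t L³`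
  no fixed point is needed.)
* `kato_fujitaKato_persistence_of_bounded` (PROVED): the core implies the persistence along
  global Kato solutions. Near `t = 0` the Fujita–Kato local solution (proved
  `fujita_kato_local_holds`) coincides a.e. with the Kato solution (proved `kato_unique_holds`,
  through `C(Ḣ^{1/2} ∩ L²) ⊂ C(L³)`, `ContinuousInHomSobolevOn.continuousInLpOn_three`), and both
  continuity classes only see slices up to null sets; away from `t = 0` the Kato solution restarts
  from `u(s)` (proved `mild_L3_restart_holds`, `isMildNSSolutionOn_translate_of_restart`) and is
  bounded on `[s, T₁] ⊂ (0, ∞)` (proved `mild_L3_interior_bounded_holds`: `‖u(t)‖_∞ ≤ C t^{-1/2}`),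
  so the core applies to `u(· + s)`; the classes are translated back and patched on `[0, ∞)`.
* `rusinSverakRhoMaxPure_le_of_persistence`, `rusinSverakRhoMaxPure_le_of_bounded` (PROVED): the
  assembly described above; `rusinSverakRhoMaxPure_le_holds` will be the latter applied to the
  discharge of the core.

Nothing is asserted: the two `def … : Prop` are statements; every `theorem` is proved.

## Mathlib / tree search

Mathlib has no Navier–Stokes theory. Tree (`lean search`): all ingredients listed above are
proved in the imported files (`MildSolutionsProofs`, `FujitaKatoDictionary`, `KatoLocalL3Exists` ⊃
`MildL3Smooth` ⊃ `MildL3RestartAveraging`, `HomSobolevWeakLimits` for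
`Function.eHomSobolevSeminorm_congr_ae`, `FourierSobolevNormProofs` for
`eLpNorm_fourier_homSobolevMeasure`); no statement linking `HasGlobalKatoSolution` and
`HasGlobalFujitaKatoSolution` existed (`lean search 'HasGlobalFujitaKatoSolution'`). Used from
Mathlib: `MeasureTheory.Lp.enorm_toLp`, `MemLp.toLp_congr`, `nhdsWithin_inter_of_mem`,
`ContinuousWithinAt.tendsto_nhdsWithin`.

## References

* W. Rusin, V. Šverák, *Minimal initial data for potential Navier–Stokes singularities*,
  J. Funct. Anal. 260 (2011) 879–891, §1 and §3 (arXiv:0911.0500, pp. 3, 5). [RusinSverak2011]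
* P. G. Lemarié-Rieusset, *The Navier–Stokes Problem in the 21st Century*, CRC Press 2016,
  doi:10.1201/b19556: Thm. 7.4 and proof (PDF p. 151), Thm. 7.5 (PDF p. 155), proof of
  Thm. 15.1 (A) (PDF p. 565). [LemarieRieusset2016]
* I. Gallagher, D. Iftimie, F. Planchon, *Asymptotics and stability for global solutions to the
  Navier–Stokes equations*, Ann. Inst. Fourier 53 (2003) 1387–1424, App., Lemma A.2
  ("propagation of regularity"). doi:10.5802/aif.1983.
* I. Gallagher, G. Koch, F. Planchon, Comm. Math. Phys. 343 (2016), p. 4 ((1.6), (1.9)). [GKP2016]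
-/

noncomputable section

open MeasureTheory Set Function Filter
open _root_.Topology
open scoped ENNReal NNReal FourierTransform

/-! ### The `Ḣ^s` norm of `ofFun f hf`, extended-real form; a.e.-invariance of `MemHomSobolev` -/

namespace Literature.Analysis.FunctionSpaces

variable {E F : Type*} [NormedAddCommGroup E] [InnerProductSpace ℝ E] [FiniteDimensional ℝ E]
  [MeasurableSpace E] [BorelSpace E] [NormedAddCommGroup F] [InnerProductSpace ℂ F]
  [CompleteSpace F]

/-- `Ḣ^s ∩ L²` membership (`MemHomSobolev`) only depends on the a.e. class of the function: the
`L²` class, hence its Fourier transform, is the same (Bahouri–Chemin–Danchin 2011, Def. 1.31).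
[cite: BahouriCheminDanchin2011, Def. 1.31] -/
theorem MemHomSobolev.congr_ae {s : ℝ} {f f' : E → F} (hf : MemHomSobolev s f)
    (h : f =ᵐ[volume] f') : MemHomSobolev s f' := by
  obtain ⟨h2, hF⟩ := hf
  refine ⟨h2.ae_eq h, ?_⟩
  rwa [← MemLp.toLp_congr h2 (h2.ae_eq h) h]

namespace HomSobolev

/-- **`‖ofFun f hf‖ₑ = ‖f‖_{Ḣ^s}`** (extended-real form of the named fact `HomSobolev.norm_ofFun`,
Bahouri–Chemin–Danchin 2011, Def. 1.31: `‖u‖²_{Ḣ^s} = ∫ |ξ|^{2s} |û(ξ)|² dξ`): `ofFun f hf` is the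
`L²(‖ξ‖^{2s} dξ)` class of `𝓕f`, whose extended norm is `eLpNorm 𝓕f 2 (‖ξ‖^{2s} dξ)`
(Mathlib `Lp.enorm_toLp`), and that is `‖f‖_{Ḣ^s}` (`eLpNorm_fourier_homSobolevMeasure`); the
function-level seminorm takes its `L²` branch at the witness `hf.choose`. No finiteness is needed
in this form. [cite: BahouriCheminDanchin2011, Def. 1.31] -/
theorem enorm_ofFun {s : ℝ} (f : E → F) (hf : MemHomSobolev s f) :
    ‖ofFun f hf‖ₑ = Function.eHomSobolevSeminorm s f := by
  change ‖hf.choose_spec.toLp _‖ₑ = _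
  rw [Lp.enorm_toLp, eLpNorm_fourier_homSobolevMeasure, Function.eHomSobolevSeminorm,
    dif_pos hf.choose]

end HomSobolev

end Literature.Analysis.FunctionSpaces

namespace Literature.Analysis.FluidPDE

open FunctionSpaces.EuclideanSpace (complexify)

/-- Local notation for physical space `ℝ³ = EuclideanSpace ℝ (Fin 3)`. -/
local notation "ℝ³" => EuclideanSpace ℝ (Fin 3)

/-- Local notation for the complexified target `ℂ³ = EuclideanSpace ℂ (Fin 3)`. -/
local notation "ℂ³" => EuclideanSpace ℂ (Fin 3)

/-! ### Tools: the class `C(S; Ḣ^s ∩ L²)` up to null sets, and time translation of the classes -/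

section Tools

/-- `C(S; Ḣ^s ∩ L²)` only sees the slices up to null sets: if `w(t) = u(t)` a.e. for every
`t ∈ S`, then `w ∈ C(S; Ḣ^s ∩ L²)` as soon as `u` is (twin of `ContinuousInLpOn.congr_ae_slices`;
membership by `MemHomSobolev.congr_ae`, moduli by `Function.eHomSobolevSeminorm_congr_ae`).
[folklore] -/
theorem ContinuousInHomSobolevOn.congr_ae_slices {S : Set ℝ} {s : ℝ} {u w : ℝ → ℝ³ → ℝ³}
    (hu : ContinuousInHomSobolevOn S s u) (h : ∀ t ∈ S, w t =ᵐ[volume] u t) :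
    ContinuousInHomSobolevOn S s w := by
  have hc : ∀ t ∈ S, (complexify ∘ u t : ℝ³ → ℂ³) =ᵐ[volume] complexify ∘ w t := fun t ht => by
    filter_upwards [h t ht] with x hx
    simp only [Function.comp_apply, hx]
  refine ⟨fun t ht => (hu.1 t ht).congr_ae (hc t ht), fun t₀ ht₀ => ?_⟩
  refine (hu.2 t₀ ht₀).congr' ?_
  filter_upwards [self_mem_nhdsWithin] with t ht
  refine Function.eHomSobolevSeminorm_congr_ae ?_
  filter_upwards [h t ht, h t₀ ht₀] with x hx hx₀
  simp only [Function.comp_apply, Pi.sub_apply, hx, hx₀]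

/-- Translating back the class `C([0, T - s); Lᵖ)` of `t ↦ u (t + s)` gives `u ∈ C([s, T); Lᵖ)`
(inverse of `ContinuousInLpOn.translate_Ico`). [folklore] -/
theorem ContinuousInLpOn.of_translate_Ico {X : Type*} [MeasureSpace X] {F' : Type*}
    [NormedAddCommGroup F'] {p : ℝ≥0∞} {u : ℝ → X → F'} {T s : ℝ}
    (h : ContinuousInLpOn (Ico 0 (T - s)) p (fun t => u (t + s))) :
    ContinuousInLpOn (Ico s T) p u := by
  have hmaps : MapsTo (fun t : ℝ => t - s) (Ico s T) (Ico 0 (T - s)) := fun t ht =>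
    ⟨by linarith [ht.1], by linarith [ht.2]⟩
  refine ⟨fun t ht => by simpa only [sub_add_cancel] using h.1 (t - s) (hmaps ht),
    fun t₀ ht₀ => ?_⟩
  have hmap : Tendsto (fun t : ℝ => t - s) (𝓝[Ico s T] t₀) (𝓝[Ico 0 (T - s)] (t₀ - s)) :=
    (continuous_id.sub continuous_const).continuousWithinAt.tendsto_nhdsWithin hmaps
  have h2 := (h.2 (t₀ - s) (hmaps ht₀)).comp hmap
  simpa only [Function.comp_def, sub_add_cancel] using h2

/-- Translating back the class `C([0, T - s); Ḣ^{σ} ∩ L²)` of `t ↦ u (t + s)` gives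
`u ∈ C([s, T); Ḣ^σ ∩ L²)`. [folklore] -/
theorem ContinuousInHomSobolevOn.of_translate_Ico {σ : ℝ} {u : ℝ → ℝ³ → ℝ³} {T s : ℝ}
    (h : ContinuousInHomSobolevOn (Ico 0 (T - s)) σ (fun t => u (t + s))) :
    ContinuousInHomSobolevOn (Ico s T) σ u := by
  have hmaps : MapsTo (fun t : ℝ => t - s) (Ico s T) (Ico 0 (T - s)) := fun t ht =>
    ⟨by linarith [ht.1], by linarith [ht.2]⟩
  refine ⟨fun t ht => by simpa only [sub_add_cancel] using h.1 (t - s) (hmaps ht),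
    fun t₀ ht₀ => ?_⟩
  have hmap : Tendsto (fun t : ℝ => t - s) (𝓝[Ico s T] t₀) (𝓝[Ico 0 (T - s)] (t₀ - s)) :=
    (continuous_id.sub continuous_const).continuousWithinAt.tendsto_nhdsWithin hmaps
  have h2 := (h.2 (t₀ - s) (hmaps ht₀)).comp hmap
  simpa only [Function.comp_def, sub_add_cancel] using h2

/-- A neighbourhood filter within `[0, ∞)` at `t₀` coincides with the one within any
`[a, b) ⊆ [0, ∞)` containing `t₀` in its interior relative to `[0, ∞)`, i.e. with `a < t₀ < b`,
or `a = 0 ≤ t₀ < b`. Stated as: `Ico a b ∈ 𝓝[Ici 0] t₀` gives `𝓝[Ici 0] t₀ = 𝓝[Ico a b] t₀` when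
`Ico a b ⊆ Ici 0`. [folklore] -/
theorem nhdsWithin_Ici_eq_nhdsWithin_Ico {a b t₀ : ℝ} (ha : 0 ≤ a) (hmem : Ico a b ∈ 𝓝[Ici 0] t₀) :
    𝓝[Ici (0 : ℝ)] t₀ = 𝓝[Ico a b] t₀ := by
  have hsub : Ico a b ⊆ Ici (0 : ℝ) := fun t ht => le_trans ha ht.1
  rw [← nhdsWithin_inter_of_mem hmem, Set.inter_eq_left.2 hsub]

end Tools

/-! ### The analytic core (named fact) and the persistence statement -/

section Facts

/-- **Persistence of `Ḣ^{1/2} ∩ L²` regularity along bounded mild solutions** (the analytic core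
of "the Kato and the Fujita–Kato solutions from `u₀ ∈ Ḣ^{1/2} ∩ L²` coincide"; standard, no single
printed source states it in this form — printed ingredients: Lemarié-Rieusset 2016,
doi:10.1201/b19556, proof of Thm. 15.1 (A), PDF p. 565: for the solution `u ∈ C([0,T*), L³)`,
"as `u ∈ L⁴((0,S),L⁴)`, we have `∫₀ᵗ W_{ν(t-s)} * ℙ div(u ⊗ u) ds ∈ C([0,S],L²) ∩ L²((0,S),H¹)`";
proof of Thm. 7.4, PDF p. 151: `‖∫₀ᵗ W_{ν(t-s)} * ℙ f ds‖_{Ḣ^{1/2}} ≤ C ∫₀ᵗ (ν(t-s))^{-1/4} ‖f‖₂ ds`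
and the `Ḣ^{3/2}` analogue with `(ν(t-s))^{-3/4}`; Rusin–Šverák 2011, §3: "the mild solutions have
the same regularity as `U`"; Gallagher–Iftimie–Planchon 2003, App., Lemma A.2 "propagation of
regularity"). Let `ν > 0`, `T > 0`, and let `v` be an unforced mild solution on `[0, T)` in the
accepted duality form (`IsMildNSSolutionOn (Ico 0 T) ν 0 u₀ v`, which includes weak
divergence-freeness of every slice, in particular of `v 0 = u₀`) from a datum
`u₀ ∈ Ḣ^{1/2} ∩ L²` (`MemHomSobolev (1/2)` of `complexify ∘ u₀`; hence `u₀ ∈ L³`), with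
`v ∈ C([0,T); L³)`, `v 0 = u₀`, `v` jointly measurable on `(0,T) × ℝ³`, and `v` essentially
bounded on `(0, T) × ℝ³` (`‖v(t)‖_{L^∞} ≤ M` for all `t ∈ (0, T)`). Then
`v ∈ C([0,T); Ḣ^{1/2} ∩ L²)` (`ContinuousInHomSobolevOn (Ico 0 T) (1/2) v`) and
`v ∈ C([0,T); L²)` (`ContinuousInLpOn (Ico 0 T) 2 v`). (Mechanism: by the duality identity and the
Helmholtz annihilator lemma in `L³ + L²`, `v(t) = e^{νtΔ}u₀ - ℙ ∫₀ᵗ e^{ν(t-τ)Δ} ∇·(v ⊗ v)(τ) dτ`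
a.e., with `v ⊗ v ∈ L^∞((0,T); L²)` since `‖v ⊗ v‖₂ ≤ ‖v‖_∞^{1/2} ‖v‖₃^{3/2}`, and
`‖e^{σΔ} ∇·F‖₂ ≤ C σ^{-1/2} ‖F‖₂`, `‖e^{σΔ} ∇·F‖_{Ḣ^{1/2}} ≤ C σ^{-3/4} ‖F‖₂`.) [folklore] -/
def bounded_mild_fujitaKato_persistence : Prop :=
  ∀ {ν T : ℝ} (_hν : 0 < ν) (_hT : 0 < T) {u₀ : ℝ³ → ℝ³} {v : ℝ → ℝ³ → ℝ³}
    (_hH : FunctionSpaces.MemHomSobolev (1 / 2 : ℝ) (complexify ∘ u₀))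
    (_hv : IsMildNSSolutionOn (Ico 0 T) ν 0 u₀ v) (_hvc : ContinuousInLpOn (Ico 0 T) 3 v)
    (_hv0 : v 0 = u₀)
    (_hmeas : AEStronglyMeasurable (uncurry v) (volume.restrict (Ioo 0 T ×ˢ univ)))
    (_hbdd : ∃ M : ℝ, ∀ t ∈ Ioo 0 T, eLpNorm (v t) ∞ volume ≤ ENNReal.ofReal M),
    ContinuousInHomSobolevOn (Ico 0 T) (1 / 2 : ℝ) v ∧ ContinuousInLpOn (Ico 0 T) 2 v

/-- **Persistence of `Ḣ^{1/2} ∩ L²` regularity along global Kato solutions** ("the Kato and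
Fujita–Kato solutions coincide and have the same maximal time", docstring of
`HasGlobalKatoSolution`; Rusin–Šverák 2011, §1 and §3, where `T_max(u₀)` for `u₀ ∈ Ḣ^{1/2}` is
defined through the mild solution and "the mild solutions have the same regularity as `U`";
Gallagher–Koch–Planchon 2016, p. 4: `T*(u₀)` "is independent of" the critical space, "due to the
embeddings and propagation of regularity results", citing Gallagher–Iftimie–Planchon 2003). For
`ν > 0` and a weakly divergence-free `u₀ ∈ Ḣ^{1/2} ∩ L²(ℝ³)`: if `u₀` has a global Kato solution
(`HasGlobalKatoSolution ν u₀`: a global mild solution in `C([0,∞); L³)`), then it has a global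
Fujita–Kato solution (`HasGlobalFujitaKatoSolution ν u₀`: a global mild solution in
`C([0,∞); Ḣ^{1/2} ∩ L²) ∩ C([0,∞); L²)`). PROVED below from `bounded_mild_fujitaKato_persistence`
(`kato_fujitaKato_persistence_of_bounded`). [folklore] -/
def kato_fujitaKato_persistence : Prop :=
  ∀ {ν : ℝ} (_hν : 0 < ν) {u₀ : ℝ³ → ℝ³}
    (_hu₀ : FunctionSpaces.MemHomSobolev (1 / 2 : ℝ) (complexify ∘ u₀)) (_hdiv : IsWeaklyDivFree u₀)
    (_hK : HasGlobalKatoSolution ν u₀), HasGlobalFujitaKatoSolution ν u₀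

end Facts

/-! ### The persistence along global Kato solutions from the bounded core -/

section Persistence

variable {ν : ℝ} {u₀ : ℝ³ → ℝ³} {u : ℝ → ℝ³ → ℝ³}

/-- **Near `t = 0`: the Kato solution is in the Fujita–Kato class on the lifespan of the local
Fujita–Kato solution.** For `ν > 0`, `u₀ ∈ Ḣ^{1/2} ∩ L²` weakly divergence free and `u` a global
mild solution in `C([0,∞); L³)` from `u₀`, measurable on `(0,∞) × ℝ³`, there is `T₁ > 0` with
`u ∈ C([0,T₁); Ḣ^{1/2} ∩ L²) ∩ C([0,T₁); L²)`: the local Fujita–Kato solution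
(`fujita_kato_local_holds`, Lemarié-Rieusset 2016, Thm. 7.4) lies in `C([0,T₁); L³)`
(`ContinuousInHomSobolevOn.continuousInLpOn_three`) and therefore agrees with `u` a.e. at every
time (`kato_unique_holds`, Furioli–Lemarié-Rieusset–Terraneo 2000 = Lemarié-Rieusset 2016,
Thm. 7.7), and the two classes only see slices up to null sets.
[cite: LemarieRieusset2016, Thm. 7.4 with Thm. 7.7] -/
theorem exists_fujitaKato_class_near_zero (hν : 0 < ν)
    (hu₀ : FunctionSpaces.MemHomSobolev (1 / 2 : ℝ) (complexify ∘ u₀)) (hdiv : IsWeaklyDivFree u₀)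
    (hmild : IsGlobalMildSolution ν 0 u₀ u) (huc : ContinuousInLpOn (Ici 0) 3 u)
    (hmeas : AEStronglyMeasurable (uncurry u) (volume.restrict (Ioi 0 ×ˢ univ))) :
    ∃ T₁ : ℝ, 0 < T₁ ∧ ContinuousInHomSobolevOn (Ico 0 T₁) (1 / 2 : ℝ) u ∧
      ContinuousInLpOn (Ico 0 T₁) 2 u := by
  obtain ⟨T₁, hT₁, v, hv, hvH, hv2, -, hvmeas⟩ := fujita_kato_local_holds ν hν u₀ hu₀ hdiv
  have hu₀3 : MemLp u₀ 3 volume :=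
    memLp_three_of_memHomSobolev_half
      FunctionSpaces.eLpNorm_three_le_eHomSobolevSeminorm_half_holds hu₀
  have hmeasT : AEStronglyMeasurable (uncurry u) (volume.restrict (Ioo 0 T₁ ×ˢ univ)) :=
    hmeas.mono_measure (Measure.restrict_mono (prod_mono Ioo_subset_Ioi_self subset_rfl) le_rfl)
  have hae : ∀ t ∈ Ico 0 T₁, u t =ᵐ[volume] v t :=
    kato_unique_holds hν hu₀3 (hmild.isMildNSSolutionOn T₁) hv (huc.mono Ico_subset_Ici_self)
      hvH.continuousInLpOn_three hmeasT hvmeas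
  exact ⟨T₁, hT₁, hvH.congr_ae_slices hae, hv2.congr_ae_slices hae⟩

/-- **Away from `t = 0`: the restarted Kato solution is bounded and the core applies.** For
`ν > 0`, `u` a global mild solution in `C([0,∞); L³)` from a weakly divergence-free `u₀ ∈ L³`,
measurable on `(0,∞) × ℝ³`, and `0 < s < T` with `u(s) ∈ Ḣ^{1/2} ∩ L²`: granted
`bounded_mild_fujitaKato_persistence`, `u ∈ C([s,T); Ḣ^{1/2} ∩ L²) ∩ C([s,T); L²)`. Indeed
`u(· + s)` is a mild solution on `[0, T - s)` from `u(s)` (restart, `mild_L3_restart_holds` through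
`isMildNSSolutionOn_translate_of_restart`), in `C([0,T-s); L³)`, measurable, and bounded by
`|C| s^{-1/2}` (`mild_L3_interior_bounded_holds` on the window `(0, T) ⊂ (0, T + 1)`;
Lemarié-Rieusset 2016, proof of Thm. 15.1 (A): "`√t u` is bounded on `(0,S) × ℝ³`").
[cite: LemarieRieusset2016, Thm. 15.1 (A), proof (PDF p. 565)] -/
theorem fujitaKato_class_of_bounded_core (hP : bounded_mild_fujitaKato_persistence) (hν : 0 < ν)
    (hu₀ : MemLp u₀ 3 volume) (hdiv₀ : IsWeaklyDivFree u₀) (hmild : IsGlobalMildSolution ν 0 u₀ u)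
    (huc : ContinuousInLpOn (Ici 0) 3 u)
    (hmeas : AEStronglyMeasurable (uncurry u) (volume.restrict (Ioi 0 ×ˢ univ)))
    {s T : ℝ} (hs : 0 < s) (hsT : s < T)
    (hHs : FunctionSpaces.MemHomSobolev (1 / 2 : ℝ) (complexify ∘ u s)) :
    ContinuousInHomSobolevOn (Ico s T) (1 / 2 : ℝ) u ∧ ContinuousInLpOn (Ico s T) 2 u := by
  have hT : 0 < T := hs.trans hsT
  have hT' : 0 < T + 1 := by linarith
  -- restrictions of the global solution to `[0, T + 1)` and to `[0, T)`
  have hmild' : IsMildNSSolutionOn (Ico 0 (T + 1)) ν 0 u₀ u := hmild.isMildNSSolutionOn (T + 1)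
  have huc' : ContinuousInLpOn (Ico 0 (T + 1)) 3 u := huc.mono Ico_subset_Ici_self
  have hmeas' : AEStronglyMeasurable (uncurry u) (volume.restrict (Ioo 0 (T + 1) ×ˢ univ)) :=
    hmeas.mono_measure (Measure.restrict_mono (prod_mono Ioo_subset_Ioi_self subset_rfl) le_rfl)
  have hmildT : IsMildNSSolutionOn (Ico 0 T) ν 0 u₀ u := hmild.isMildNSSolutionOn T
  have hucT : ContinuousInLpOn (Ico 0 T) 3 u := huc.mono Ico_subset_Ici_self
  have hmeasT : AEStronglyMeasurable (uncurry u) (volume.restrict (Ioo 0 T ×ˢ univ)) :=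
    hmeas.mono_measure (Measure.restrict_mono (prod_mono Ioo_subset_Ioi_self subset_rfl) le_rfl)
  -- interior bound `‖u(t)‖_∞ ≤ C t^{-1/2}` on `(0, T)`
  obtain ⟨C, hC⟩ := mild_L3_interior_bounded_holds hν hT' hu₀ hdiv₀ hmild' huc' hmeas' T
    ⟨hT, by linarith⟩
  -- the restarted solution `u(· + s)` on `[0, T - s)`
  have hw : IsMildNSSolutionOn (Ico 0 (T - s)) ν 0 (u s) (fun t => u (t + s)) :=
    isMildNSSolutionOn_translate_of_restart mild_L3_restart_holds hν hT hu₀ hmildT hucT hmeasT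
      ⟨hs.le, hsT⟩
  have hwc : ContinuousInLpOn (Ico 0 (T - s)) 3 (fun t => u (t + s)) :=
    hucT.translate_Ico hs.le le_rfl
  have hw0 : (fun t => u (t + s)) 0 = u s := by
    show u (0 + s) = u s
    rw [zero_add]
  have hwmeas : AEStronglyMeasurable (uncurry fun t => u (t + s))
      (volume.restrict (Ioo 0 (T - s) ×ˢ univ)) :=
    aestronglyMeasurable_uncurry_translate hs.le hmeasT
  have hwbdd : ∃ M : ℝ, ∀ t ∈ Ioo 0 (T - s),
      eLpNorm ((fun t => u (t + s)) t) ∞ volume ≤ ENNReal.ofReal M := by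
    refine ⟨|C| / Real.sqrt s, fun t ht => ?_⟩
    have hts : t + s ∈ Ioo 0 T := ⟨by linarith [ht.1], by linarith [ht.2]⟩
    refine (hC _ hts).trans (ENNReal.ofReal_le_ofReal ?_)
    have h1 : Real.sqrt s ≤ Real.sqrt (t + s) := Real.sqrt_le_sqrt (by linarith [ht.1])
    have h2 : 0 < Real.sqrt s := Real.sqrt_pos.2 hs
    calc C / Real.sqrt (t + s) ≤ |C| / Real.sqrt (t + s) :=
          div_le_div_of_nonneg_right (le_abs_self C) (h2.trans_le h1).le
      _ ≤ |C| / Real.sqrt s := div_le_div_of_nonneg_left (abs_nonneg C) h2 h1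
  obtain ⟨hH, h2⟩ := hP hν (by linarith : 0 < T - s) hHs hw hwc hw0 hwmeas hwbdd
  exact ⟨hH.of_translate_Ico, h2.of_translate_Ico⟩

/-- **Persistence along global Kato solutions from the bounded core, PROVED**:
`bounded_mild_fujitaKato_persistence → kato_fujitaKato_persistence`. The global Kato solution `u`
itself is the Fujita–Kato solution: on `[0, T₁)` by `exists_fujitaKato_class_near_zero`, on every
`[T₁/2, T)` by `fujitaKato_class_of_bounded_core` (datum `u(T₁/2) ∈ Ḣ^{1/2} ∩ L²` from the first
step); continuity at `t₀ ∈ [0, ∞)` is read off in the window containing `t₀` in its (relative)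
interior. (Rusin–Šverák 2011, §3: "for short times they are just a perturbation of `U`, and this
can be iterated forward to the time interval where the solution exists".)
[cite: RusinSverak2011, §3 (arXiv:0911.0500 p. 5)] -/
theorem kato_fujitaKato_persistence_of_bounded (hP : bounded_mild_fujitaKato_persistence) :
    kato_fujitaKato_persistence := by
  intro ν hν u₀ hu₀ hdiv hK
  obtain ⟨u, hmild, huc, hu0, hmeas⟩ := hK
  have hu₀3 : MemLp u₀ 3 volume :=
    memLp_three_of_memHomSobolev_half
      FunctionSpaces.eLpNorm_three_le_eHomSobolevSeminorm_half_holds hu₀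
  obtain ⟨T₁, hT₁, hH₁, h2₁⟩ := exists_fujitaKato_class_near_zero hν hu₀ hdiv hmild huc hmeas
  have hs : 0 < T₁ / 2 := by positivity
  have hs₁ : T₁ / 2 < T₁ := by linarith
  have hHs : FunctionSpaces.MemHomSobolev (1 / 2 : ℝ) (complexify ∘ u (T₁ / 2)) :=
    hH₁.1 (T₁ / 2) ⟨hs.le, hs₁⟩
  have hwin : ∀ T : ℝ, T₁ / 2 < T →
      ContinuousInHomSobolevOn (Ico (T₁ / 2) T) (1 / 2 : ℝ) u ∧ ContinuousInLpOn (Ico (T₁ / 2) T) 2 u :=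
    fun T hT => fujitaKato_class_of_bounded_core hP hν hu₀3 hdiv hmild huc hmeas hs hT hHs
  -- neighbourhoods within `[0, ∞)` seen in the two kinds of windows
  have hnhds₀ : ∀ t₀ : ℝ, 0 ≤ t₀ → t₀ < T₁ → 𝓝[Ici (0 : ℝ)] t₀ = 𝓝[Ico 0 T₁] t₀ := fun t₀ _ ht => by
    refine nhdsWithin_Ici_eq_nhdsWithin_Ico le_rfl ?_
    rw [← Set.Ici_inter_Iio]
    exact inter_mem_nhdsWithin _ (Iio_mem_nhds ht)
  have hnhds₁ : ∀ t₀ : ℝ, T₁ ≤ t₀ →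
      𝓝[Ici (0 : ℝ)] t₀ = 𝓝[Ico (T₁ / 2) (t₀ + 1)] t₀ := fun t₀ ht => by
    refine nhdsWithin_Ici_eq_nhdsWithin_Ico hs.le ?_
    exact mem_nhdsWithin_of_mem_nhds
      (Filter.mem_of_superset (Ioo_mem_nhds (by linarith) (by linarith)) Ioo_subset_Ico_self)
  refine ⟨u, hmild, ⟨fun t ht => ?_, fun t₀ ht₀ => ?_⟩, ⟨fun t ht => ?_, fun t₀ ht₀ => ?_⟩,
    hu0, hmeas⟩
  · by_cases htT : t < T₁
    · exact hH₁.1 t ⟨ht, htT⟩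
    · exact (hwin (t + 1) (by linarith [not_lt.1 htT])).1.1 t
        ⟨by linarith [not_lt.1 htT], by linarith⟩
  · by_cases htT : t₀ < T₁
    · rw [hnhds₀ t₀ ht₀ htT]
      exact hH₁.2 t₀ ⟨ht₀, htT⟩
    · have hle : T₁ ≤ t₀ := not_lt.1 htT
      rw [hnhds₁ t₀ hle]
      exact (hwin (t₀ + 1) (by linarith)).1.2 t₀ ⟨by linarith, by linarith⟩
  · by_cases htT : t < T₁
    · exact h2₁.1 t ⟨ht, htT⟩
    · exact (hwin (t + 1) (by linarith [not_lt.1 htT])).2.1 t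
        ⟨by linarith [not_lt.1 htT], by linarith⟩
  · by_cases htT : t₀ < T₁
    · rw [hnhds₀ t₀ ht₀ htT]
      exact h2₁.2 t₀ ⟨ht₀, htT⟩
    · have hle : T₁ ≤ t₀ := not_lt.1 htT
      rw [hnhds₁ t₀ hle]
      exact (hwin (t₀ + 1) (by linarith)).2.2 t₀ ⟨by linarith, by linarith⟩

end Persistence

/-! ### The assembly: `ρ_max^pure ≤ ρ_max` from the persistence -/

section Assembly

/-- **`rusinSverakRhoMaxPure_le` from the persistence**, PROVED (the argument of the fact's
docstring, `MildSolutions.lean`): a finite-energy datum `u₀ ∈ Ḣ^{1/2} ∩ L²` below the pure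
threshold is an `L³` field (`memLp_three_of_memHomSobolev_half`, BCD 2011, Thm. 1.38),
represented by `HomSobolev.ofFun _ hu₀` (`HomSobolev.represents_ofFun_holds`) with
`‖ofFun _ hu₀‖ₑ = ‖u₀‖_{Ḣ^{1/2}}` (`HomSobolev.enorm_ofFun`), hence has a global Kato solution
(`hasGlobalKatoSolution_of_lt_rusinSverakRhoMaxPure`), hence — persistence — a global Fujita–Kato
solution; so `ρ_max^pure(ν)` belongs to the set of radii defining `ρ_max(ν)`. [folklore] -/
theorem rusinSverakRhoMaxPure_le_of_persistence (hP : kato_fujitaKato_persistence) :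
    rusinSverakRhoMaxPure_le := by
  intro ν hν
  unfold rusinSverakRhoMax
  refine le_sSup ?_
  rw [Set.mem_setOf_eq]
  intro u₀ hu₀ hdiv hlt
  have hu₀3 : MemLp u₀ 3 volume :=
    memLp_three_of_memHomSobolev_half
      FunctionSpaces.eLpNorm_three_le_eHomSobolevSeminorm_half_holds hu₀
  have hE : 0 < Module.finrank ℝ ℝ³ := by
    rw [finrank_euclideanSpace_fin]
    norm_num
  have hrep : (FunctionSpaces.HomSobolev.ofFun (complexify ∘ u₀) hu₀).Represents (complexify ∘ u₀) :=
    FunctionSpaces.HomSobolev.represents_ofFun_holds hE (complexify ∘ u₀) hu₀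
  have hlt' : ‖FunctionSpaces.HomSobolev.ofFun (complexify ∘ u₀) hu₀‖ₑ < rusinSverakRhoMaxPure ν := by
    rwa [FunctionSpaces.HomSobolev.enorm_ofFun]
  exact hP hν hu₀ hdiv (hasGlobalKatoSolution_of_lt_rusinSverakRhoMaxPure hu₀3 hrep hdiv hlt')

/-- **`rusinSverakRhoMaxPure_le` from the bounded core**, PROVED: composition of
`rusinSverakRhoMaxPure_le_of_persistence` with `kato_fujitaKato_persistence_of_bounded`. Once
`bounded_mild_fujitaKato_persistence` is discharged, `rusinSverakRhoMaxPure_le_holds` is this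
theorem applied to that discharge. [folklore] -/
theorem rusinSverakRhoMaxPure_le_of_bounded (hP : bounded_mild_fujitaKato_persistence) :
    rusinSverakRhoMaxPure_le :=
  rusinSverakRhoMaxPure_le_of_persistence (kato_fujitaKato_persistence_of_bounded hP)

end Assembly



end Literature.Analysis.FluidPDE
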